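import Summits.ResolutionOfSingularities.KangarooAtlas.MizutaniRationalPoints
import Summits.ResolutionOfSingularities.KangarooAtlas.MizutaniSpecialization
import Mathlib.RingTheory.MvPolynomial.Expand
import HarnessLib

/-!
# The most generic point of a Hironaka scheme (Mizutani 1973 §1 (d), Thm. 1.3)

Cell `pub-rosobs`, Mizutani enclosure (seat mizutani-encloser-1, gen 8).  AI-written; *AI review is weaker than
expert review*; NOT a resolution-of-singularities theorem (summit relevance C).

Mizutani 1973 §1 (d): «We call `p` in `ℙⁿ` the most generic point associated with an H-scheme `B` in `Spec S` when
`B_{ℙⁿ,p} = B` and an arbitrary `y ∈ ℙⁿ` which satisfies `B_{ℙⁿ,y} = B` contains `p`»; Thm. 1.3 (= Oda 1973 Thm. 2.5):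
«`γ(𝒥_e𝒟_e(N_e)·S)` is the most generic point associated with `Spec(S/N·S)`».  This file constructs the most generic
point of the scheme `B(𝔭) = B_{P,𝔭}` of an arbitrary point `𝔭` of `ℙ^n_k` in the tree's vocabulary (Oda's `invForms`,
`ExponentLE`, `exponent`; Hironaka's `bIdeal = U_+(𝔭)S`), WITHOUT Oda's operators `𝒥`, `𝒟`:

* `genForms k p 𝔭 e` — the `k`-span `W_e ⊂ k^{n+1}` of the vectors `F^{e−j}(D a)`, `j ≤ e`, `a ∈ (L_B)_j(𝔭)`,
  `D ∈ Diff_{p^j−1}(k/k^{p^j})` (all the data the invariant forms of levels `≤ e` produce, pushed to level `e`);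
  every `Σ v_i X_i^{p^e}`, `v ∈ W_e`, lies in EVERY point `𝔶` with `(L_B)_j(𝔶) ⊇ (L_B)_j(𝔭)` (`j ≤ e`);
* `genLinIdeal k p 𝔭 e = (Σ v_i X_i : v ∈ W_e)` (prime, generated by LINEAR forms) and
  **`genPoint k p 𝔭 e = {f : f^{(F^e)} ∈ genLinIdeal}`** (`f^{(F^e)}` = `F^e` on the coefficients; the generic point of
  the preimage of the linear space `V(genLinIdeal)` under the `k`-linear Frobenius `x ↦ x^{p^e}` of `ℙ^n`);
* `genPoint_le` — `genPoint k p 𝔭 e ⊆ 𝔶` for every prime `𝔶` with `(L_B)_j(𝔭) ⊆ (L_B)_j(𝔶)` for `j ≤ e`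
  (`f^q = f^{(F^e)}(X^q)`); in particular `⊆ 𝔭`, and `⊆` every point with the same Hironaka scheme
  (`genPoint_le_of_bIdeal_eq`: `U_+(𝔶)S = U_+(𝔭)S ⇒ (U ∩ L)_j` agree (`addForm_mem_bIdeal_iff`) `⇒ (L_B)_j` agree
  (`hirForms_eq_invForms`));
* `invForms_genPoint_eq` — if `exponent B(𝔭) ≤ e` then `(L_B)_j(genPoint) = (L_B)_j(𝔭)` for all `j`, hence
  `bIdeal_genPoint_eq` (`U_+(genPoint)S = U_+(𝔭)S`), `exponent_genPoint_eq`, `hsDim_genPoint_eq`, `isPoint_genPoint`;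
* **`genPoint_isMostGeneric`** — for every point `𝔭` of `ℙ^n_k`, `𝔤 := genPoint k p 𝔭 (exponent k p 𝔭)` is a point with
  `B_{P,𝔤} = B_{P,𝔭}` contained in every point `𝔶` with `B_{P,𝔶} = B_{P,𝔭}`: THE MOST GENERIC POINT EXISTS, and it is
  `q`-linear (`q = p^{exponent}`); `eq_genPoint_of_forall_le` (it is unique).

## References

* H. Mizutani, *Hironaka's additive group schemes*, Nagoya Math. J. 52 (1973) 85–95, §1 (d) and Thm. 1.3 (p. 86).
  [Mizutani1973HironakaGroupSchemes]
* T. Oda, *Hironaka's additive group scheme, II*, Publ. RIMS 19 (1983), Thm. 3.1 (p. 1173: "a versal family").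
  [Oda1983HironakaGroupSchemeII]
-/

noncomputable section

open MvPolynomial Literature.AlgebraicGeometry.Resolution Literature.AlgebraicGeometry.Resolution.HironakaScheme
  Literature.RingTheory.MvPolynomial Literature.RingTheory.HilbertSamuel

namespace Summit.ResolutionOfSingularities.KangarooAtlas.Mizutani

universe u

section GenPoint

variable (k : Type u) [Field k] (p : ℕ) [hp : Fact p.Prime] [CharP k p] {n : ℕ}
  (𝔭 : Ideal (MvPolynomial (Fin (n + 1)) k)) (e : ℕ)

/-- **`W_e(𝔭)`**: the `k`-span in `k^{n+1}` of the vectors `F^{e−j}(D a)` for `j ≤ e`, `a ∈ (L_B)_j(𝔭)`,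
`D ∈ Diff_{p^j−1}(k/k^{p^j})` (all the data produced by the invariant forms of levels `≤ e`, pushed to level `e`).
[cite: Mizutani1973HironakaGroupSchemes, Thm. 1.3 (𝒟_e(N_e), and N = rad_L(k[F]N_e))] -/
noncomputable def genForms : Submodule k (Fin (n + 1) → k) :=
  Submodule.span k {v | ∃ j, j ≤ e ∧ ∃ a ∈ invForms k p 𝔭 j, ∃ D : k →ₗ[frobPow k p j] k,
    IsDiffOpLE (frobPow k p j) (p ^ j - 1) D ∧ v = frobVec k p (e - j) (fun i => D (a i))}

/-- `(Σ v_i X_i : v ∈ W_e(𝔭))`, an ideal generated by linear forms. [cite: Mizutani1973HironakaGroupSchemes, Thm. 1.3 (𝒥_e𝒟_e(N_e)·S)] -/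
noncomputable def genLinIdeal : Ideal (MvPolynomial (Fin (n + 1)) k) :=
  Ideal.span (linForm '' (genForms k p 𝔭 e : Set (Fin (n + 1) → k)))

/-- **The candidate most generic point at level `e`**: `{f : f^{(F^e)} ∈ genLinIdeal}`.
[cite: Mizutani1973HironakaGroupSchemes, §1 (d) and Thm. 1.3 (γ(𝒥_e𝒟_e(N_e)S))] -/
noncomputable def genPoint : Ideal (MvPolynomial (Fin (n + 1)) k) :=
  (genLinIdeal k p 𝔭 e).comap (MvPolynomial.map (iterateFrobenius k p e))

/-- `genLinIdeal` is prime. [folklore] -/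
theorem isPrime_genLinIdeal : (genLinIdeal k p 𝔭 e).IsPrime := by
  unfold genLinIdeal
  exact isPrime_span_linForm _

/-- `genPoint` is prime. [folklore] -/
theorem isPrime_genPoint : (genPoint k p 𝔭 e).IsPrime := by
  haveI := isPrime_genLinIdeal k p 𝔭 e
  unfold genPoint
  exact Ideal.comap_isPrime _ _

/-- Membership in `genPoint`. [folklore] -/
theorem mem_genPoint_iff {f : MvPolynomial (Fin (n + 1)) k} :
    f ∈ genPoint k p 𝔭 e ↔ MvPolynomial.map (iterateFrobenius k p e) f ∈ genLinIdeal k p 𝔭 e := Ideal.mem_comap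

/-! ### Polynomial identities (local copies where the Frobenius-generization file is not yet importable) -/

/-- `f^{(F^e)}(X^q) = f^q`. [folklore] -/
private theorem expand_map_iterateFrobenius' (f : MvPolynomial (Fin (n + 1)) k) :
    expand (p ^ e) (MvPolynomial.map (iterateFrobenius k p e) f) = f ^ p ^ e := by
  rw [← map_expand, map_iterateFrobenius_expand]

omit hp [CharP k p] in
/-- A linear form is the additive form of level `0`. [folklore] -/
private theorem linForm_eq_addForm_zero' (h : Fin (n + 1) → k) : linForm h = addForm k p 0 h := by
  rw [linForm_apply]
  unfold addForm
  exact Finset.sum_congr rfl fun i _ => by rw [pow_zero, pow_one, smul_eq_C_mul]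

/-- `(Σ g_i X_i^{p^j})^{(F^e)} = Σ g_i^{p^e} X_i^{p^j}`. [folklore] -/
private theorem map_iterateFrobenius_addForm' (j : ℕ) (g : Fin (n + 1) → k) :
    MvPolynomial.map (iterateFrobenius k p e) (addForm k p j g) = addForm k p j (frobVec k p e g) := by
  unfold addForm frobVec
  rw [map_sum]
  refine Finset.sum_congr rfl fun i _ => ?_
  rw [map_mul, map_pow, map_C, map_X, iterateFrobenius_def]

/-- Homogeneous components commute with a change of coefficients. [folklore] -/
private theorem homogeneousComponent_map'' {R S : Type*} [CommRing R] [CommRing S] (f : R →+* S) (a : ℕ)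
    (G : MvPolynomial (Fin (n + 1)) R) :
    homogeneousComponent a (MvPolynomial.map f G) = MvPolynomial.map f (homogeneousComponent a G) := by
  classical
  refine MvPolynomial.ext _ _ fun m => ?_
  rw [coeff_homogeneousComponent, coeff_map, coeff_map, coeff_homogeneousComponent]
  split_ifs <;> simp

/-! ### The generic point lies in every point carrying the invariant forms -/

/-- **`Σ v_i X_i^{p^e} ∈ 𝔶` for `v ∈ W_e(𝔭)` and every ideal `𝔶` with `(L_B)_j(𝔭) ⊆ (L_B)_j(𝔶)`, `j ≤ e`**
(generators: `addForm e (F^{e−j}(Da)) = (addForm j (Da))^{p^{e−j}}` and `addForm j (Da) ∈ 𝔶` is the DEFINITION of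
`a ∈ (L_B)_j(𝔶)`). [cite: Oda1983HironakaGroupSchemeII, §2 (p. 1168: (L_B)_e = {h : Dh ∈ 𝔭 ∀ D})] -/
theorem addForm_mem_of_mem_genForms {𝔶 : Ideal (MvPolynomial (Fin (n + 1)) k)}
    (h𝔶 : ∀ j, j ≤ e → invForms k p 𝔭 j ≤ invForms k p 𝔶 j) {v : Fin (n + 1) → k} (hv : v ∈ genForms k p 𝔭 e) :
    addForm k p e v ∈ 𝔶 := by
  have hle : genForms k p 𝔭 e ≤ (Submodule.restrictScalars k 𝔶).comap (addFormLin k p e) := by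
    unfold genForms
    rw [Submodule.span_le]
    rintro v ⟨j, hj, a, ha, D, hD, rfl⟩
    rw [SetLike.mem_coe, Submodule.mem_comap, addFormLin_apply, Submodule.restrictScalars_mem]
    have hmem : addForm k p j (fun i => D (a i)) ∈ 𝔶 := h𝔶 j hj ha D hD
    have hpow := Ideal.pow_mem_of_mem 𝔶 hmem (p ^ (e - j)) (Nat.one_le_pow _ _ hp.out.pos)
    rw [addForm_pow_pow, Nat.add_sub_cancel' hj] at hpow
    exact hpow
  have := hle hv
  rw [Submodule.mem_comap, addFormLin_apply, Submodule.restrictScalars_mem] at this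
  exact this

/-- **`genPoint k p 𝔭 e ⊆ 𝔶`** for every prime `𝔶` with `(L_B)_j(𝔭) ⊆ (L_B)_j(𝔶)` for `j ≤ e`: if `f^{(F^e)} ∈ genLinIdeal`
then `f^q = f^{(F^e)}(X^q) ∈ (Σ v_i X_i^q : v ∈ W_e) ⊆ 𝔶`. [cite: Mizutani1973HironakaGroupSchemes, §1 (d)] -/
theorem genPoint_le {𝔶 : Ideal (MvPolynomial (Fin (n + 1)) k)} [𝔶.IsPrime]
    (h𝔶 : ∀ j, j ≤ e → invForms k p 𝔭 j ≤ invForms k p 𝔶 j) : genPoint k p 𝔭 e ≤ 𝔶 := by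
  intro f hf
  rw [mem_genPoint_iff] at hf
  have hmap : (genLinIdeal k p 𝔭 e).map
      ((expand (p ^ e) : MvPolynomial (Fin (n + 1)) k →ₐ[k] MvPolynomial (Fin (n + 1)) k) :
        MvPolynomial (Fin (n + 1)) k →+* MvPolynomial (Fin (n + 1)) k) ≤ 𝔶 := by
    unfold genLinIdeal
    rw [Ideal.map_span, Ideal.span_le]
    rintro _ ⟨_, ⟨v, hv, rfl⟩, rfl⟩
    rw [SetLike.mem_coe, RingHom.coe_coe, expand_linForm, ← addForm_eq_powForm]
    exact addForm_mem_of_mem_genForms k p 𝔭 e h𝔶 hv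
  have h := hmap (Ideal.mem_map_of_mem _ hf)
  rw [RingHom.coe_coe, expand_map_iterateFrobenius'] at h
  exact Ideal.IsPrime.mem_of_pow_mem inferInstance _ h

/-- In particular `genPoint k p 𝔭 e ⊆ 𝔭`. [cite: Mizutani1973HironakaGroupSchemes, §1 (d)] -/
theorem genPoint_le_self [𝔭.IsPrime] : genPoint k p 𝔭 e ≤ 𝔭 := genPoint_le k p 𝔭 e fun _ _ => le_rfl

/-! ### The generic point carries the invariant forms -/

/-- **`(L_B)_j(𝔭) ⊆ (L_B)_j(genPoint k p 𝔭 e)` for `j ≤ e`**: `(addForm j (Da))^{(F^e)} = (Σ (Da_i)^{p^{e−j}} X_i)^{p^j}` and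
`F^{e−j}(Da) ∈ W_e`. [cite: Mizutani1973HironakaGroupSchemes, Thm. 1.3] -/
theorem invForms_le_invForms_genPoint {j : ℕ} (hj : j ≤ e) :
    invForms k p 𝔭 j ≤ invForms k p (genPoint k p 𝔭 e) j := by
  intro a ha D hD
  show addForm k p j (fun i => D (a i)) ∈ genPoint k p 𝔭 e
  rw [mem_genPoint_iff, map_iterateFrobenius_addForm']
  set w : Fin (n + 1) → k := fun i => D (a i) with hw
  set v : Fin (n + 1) → k := frobVec k p (e - j) w with hv
  have hF : frobVec k p e w = frobVec k p j v := by
    rw [hv, frobVec_frobVec]; congr 1; omega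
  have hpow : addForm k p j (frobVec k p j v) = linForm v ^ p ^ j := by
    rw [linForm_eq_addForm_zero' k p, addForm_pow_pow, Nat.zero_add]
  rw [hF, hpow]
  have hvW : v ∈ genForms k p 𝔭 e := Submodule.subset_span ⟨j, hj, a, ha, D, hD, rfl⟩
  have hgen : linForm v ∈ genLinIdeal k p 𝔭 e := Ideal.subset_span ⟨v, hvW, rfl⟩
  exact Ideal.pow_mem_of_mem _ hgen _ (Nat.pos_of_ne_zero (pow_ne_zero _ hp.out.ne_zero))

/-- **Same invariant forms at every level** when `exponent B(𝔭) ≤ e`. [cite: Mizutani1973HironakaGroupSchemes, §1 (d) and Thm. 1.3] -/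
theorem invForms_genPoint_eq [𝔭.IsPrime] (hE : ExponentLE k p 𝔭 e) (j : ℕ) :
    invForms k p (genPoint k p 𝔭 e) j = invForms k p 𝔭 j := by
  apply le_antisymm (invForms_mono k p (genPoint_le_self k p 𝔭 e) j)
  rcases le_or_gt j e with hj | hj
  · exact invForms_le_invForms_genPoint k p 𝔭 e hj
  · obtain ⟨m, rfl⟩ := Nat.exists_eq_add_of_lt hj
    rw [show e + m + 1 = e + (m + 1) from rfl, hE (e + (m + 1)) (Nat.le_add_right _ _), Nat.add_sub_cancel_left]
    calc Submodule.span k (frobVec k p (m + 1) '' (invForms k p 𝔭 e : Set (Fin (n + 1) → k)))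
        ≤ Submodule.span k (frobVec k p (m + 1) '' (invForms k p (genPoint k p 𝔭 e) e : Set (Fin (n + 1) → k))) :=
          Submodule.span_mono (Set.image_mono (invForms_le_invForms_genPoint k p 𝔭 e le_rfl))
      _ ≤ invForms k p (genPoint k p 𝔭 e) (e + (m + 1)) := span_frobVec_pow_image_le k p _ e (m + 1)

/-- `ExponentLE` transfers. [folklore] -/
theorem exponentLE_genPoint_iff [𝔭.IsPrime] (hE : ExponentLE k p 𝔭 e) (e' : ℕ) :
    ExponentLE k p (genPoint k p 𝔭 e) e' ↔ ExponentLE k p 𝔭 e' := by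
  unfold ExponentLE
  simp_rw [invForms_genPoint_eq k p 𝔭 e hE]

/-- Same exponent. [cite: Mizutani1973HironakaGroupSchemes, §1 (d)] -/
theorem exponent_genPoint_eq [𝔭.IsPrime] (hE : ExponentLE k p 𝔭 e) :
    exponent k p (genPoint k p 𝔭 e) = exponent k p 𝔭 := by
  unfold exponent
  congr 1
  ext e'
  exact exponentLE_genPoint_iff k p 𝔭 e hE e'

/-- Same dimension. [cite: Mizutani1973HironakaGroupSchemes, §1 (d) and Thm. 1.3] -/
theorem hsDim_genPoint_eq [𝔭.IsPrime] (hE : ExponentLE k p 𝔭 e) :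
    hsDim k p (genPoint k p 𝔭 e) = hsDim k p 𝔭 := by
  unfold hsDim hsDimAt
  rw [exponent_genPoint_eq k p 𝔭 e hE, invForms_genPoint_eq k p 𝔭 e hE]

/-- `genLinIdeal` is homogeneous (generated by linear forms). [folklore] -/
theorem isHomogeneousIdeal_genLinIdeal : IsHomogeneousIdeal (genLinIdeal k p 𝔭 e) := by
  unfold genLinIdeal
  refine isHomogeneousIdeal_span_of_isHomogeneous ?_
  rintro _ ⟨g, -, rfl⟩
  exact ⟨1, isHomogeneous_linForm g⟩

/-- `genPoint` is a point of `ℙ^n_k` when `𝔭` is. [cite: Mizutani1973HironakaGroupSchemes, §1 (d)] -/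
theorem isPoint_genPoint (hP : IsPoint k 𝔭) : IsPoint k (genPoint k p 𝔭 e) := by
  haveI := hP.1
  refine ⟨isPrime_genPoint k p 𝔭 e, fun f hf d => ?_, fun hle => hP.2.2 (hle.trans (genPoint_le_self k p 𝔭 e))⟩
  rw [mem_genPoint_iff] at hf ⊢
  rw [← homogeneousComponent_map'']
  exact isHomogeneousIdeal_genLinIdeal k p 𝔭 e _ hf d

/-- **Same Hironaka scheme**: `U_+(genPoint)S = U_+(𝔭)S` when `exponent B(𝔭) ≤ e`.
[cite: Mizutani1973HironakaGroupSchemes, §1 (d) and Thm. 1.3] -/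
theorem bIdeal_genPoint_eq [𝔭.IsPrime] (hP : IsPoint k 𝔭) (hE : ExponentLE k p 𝔭 e) :
    (haveI := isPrime_genPoint k p 𝔭 e; bIdeal k (genPoint k p 𝔭 e)) = bIdeal k 𝔭 := by
  haveI := isPrime_genPoint k p 𝔭 e
  rw [bIdeal_eq_famIdeal_hirForms_holds k p _ (isPoint_genPoint k p 𝔭 e hP), bIdeal_eq_famIdeal_hirForms_holds k p 𝔭 hP]
  have h : hirForms k p (genPoint k p 𝔭 e) = hirForms k p 𝔭 := by
    funext j
    rw [hirForms_eq_invForms _ j, hirForms_eq_invForms 𝔭 j, invForms_genPoint_eq k p 𝔭 e hE j]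
  rw [h]

/-! ### The most generic point -/

/-- **Points with the same Hironaka scheme have the same invariant forms**, so `genPoint k p 𝔭 e ⊆ 𝔶` whenever
`U_+(𝔶)S = U_+(𝔭)S` (any level `e`). [cite: Mizutani1973HironakaGroupSchemes, §1 (d) (B_{ℙⁿ,y} = B)] -/
theorem genPoint_le_of_bIdeal_eq [𝔭.IsPrime] (hP : IsPoint k 𝔭) {𝔶 : Ideal (MvPolynomial (Fin (n + 1)) k)} [𝔶.IsPrime]
    (hY : IsPoint k 𝔶) (h : bIdeal k 𝔶 = bIdeal k 𝔭) : genPoint k p 𝔭 e ≤ 𝔶 := by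
  refine genPoint_le k p 𝔭 e fun j _ a ha => ?_
  rw [← hirForms_eq_invForms _ j] at ha ⊢
  rw [← addForm_mem_bIdeal_iff k p 𝔶 hY, h]
  exact (addForm_mem_bIdeal_iff k p 𝔭 hP).mpr ha

/-- **THE MOST GENERIC POINT OF A HIRONAKA SCHEME EXISTS** (Mizutani 1973 §1 (d), Thm. 1.3): for every point `𝔭` of
`ℙ^n_k` (every field `k` of characteristic `p`, every `n`), the ideal `𝔤 = genPoint k p 𝔭 (exponent k p 𝔭)` is a point
with THE SAME Hironaka scheme `U_+(𝔤)S = U_+(𝔭)S`, and EVERY point `𝔶` with `U_+(𝔶)S = U_+(𝔭)S` contains `𝔤` (specialises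
from it).  `𝔤` is `q`-linear, `q = p^{exponent}`: its ideal is the pull-back, under `f ↦ f^{(F^e)}`, of an ideal generated by
linear forms.  AI-written; *AI review is weaker than expert review*; not a resolution theorem.
[cite: Mizutani1973HironakaGroupSchemes, §1 (d) and Thm. 1.3 ("γ(𝒥_e𝒟_e(N_e)S) is the most generic point associated with Spec(S/N·S)")] -/
theorem genPoint_isMostGeneric [𝔭.IsPrime] (hP : IsPoint k 𝔭) :
    IsPoint k (genPoint k p 𝔭 (exponent k p 𝔭)) ∧
    (haveI := isPrime_genPoint k p 𝔭 (exponent k p 𝔭); bIdeal k (genPoint k p 𝔭 (exponent k p 𝔭))) = bIdeal k 𝔭 ∧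
    ∀ (𝔶 : Ideal (MvPolynomial (Fin (n + 1)) k)) [𝔶.IsPrime], IsPoint k 𝔶 → bIdeal k 𝔶 = bIdeal k 𝔭 →
      genPoint k p 𝔭 (exponent k p 𝔭) ≤ 𝔶 :=
  ⟨isPoint_genPoint k p 𝔭 _ hP, bIdeal_genPoint_eq k p 𝔭 _ hP (exponentLE_exponent k p 𝔭),
    fun _ _ hY h => genPoint_le_of_bIdeal_eq k p 𝔭 _ hP hY h⟩

/-- **Uniqueness of the most generic point**: a point `𝔶` with the same scheme as `𝔭` which lies in every point with that
scheme IS `genPoint k p 𝔭 (exponent k p 𝔭)`. [cite: Mizutani1973HironakaGroupSchemes, §1 (d)] -/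
theorem eq_genPoint_of_forall_le [𝔭.IsPrime] (hP : IsPoint k 𝔭) {𝔶 : Ideal (MvPolynomial (Fin (n + 1)) k)} [𝔶.IsPrime]
    (hY : IsPoint k 𝔶) (h : bIdeal k 𝔶 = bIdeal k 𝔭)
    (hmin : ∀ (𝔷 : Ideal (MvPolynomial (Fin (n + 1)) k)) [𝔷.IsPrime], IsPoint k 𝔷 → bIdeal k 𝔷 = bIdeal k 𝔭 → 𝔶 ≤ 𝔷) :
    𝔶 = genPoint k p 𝔭 (exponent k p 𝔭) := by
  haveI := isPrime_genPoint k p 𝔭 (exponent k p 𝔭)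
  obtain ⟨hG, hB, hle⟩ := genPoint_isMostGeneric k p 𝔭 hP
  exact le_antisymm (hmin _ hG hB) (hle 𝔶 hY h)

/-- The construction does not depend on the level `e ≥ exponent B(𝔭)`: `genPoint k p 𝔭 e = genPoint k p 𝔭 (exponent k p 𝔭)`.
[cite: Mizutani1973HironakaGroupSchemes, §1 (d)] -/
theorem genPoint_eq_of_exponentLE [𝔭.IsPrime] (hP : IsPoint k 𝔭) (hE : ExponentLE k p 𝔭 e) :
    genPoint k p 𝔭 e = genPoint k p 𝔭 (exponent k p 𝔭) := by
  haveI := isPrime_genPoint k p 𝔭 e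
  exact eq_genPoint_of_forall_le k p 𝔭 hP (isPoint_genPoint k p 𝔭 e hP) (bIdeal_genPoint_eq k p 𝔭 e hP hE)
    fun 𝔷 _ hZ h => genPoint_le_of_bIdeal_eq k p 𝔭 e hP hZ h

end GenPoint

end Summit.ResolutionOfSingularities.KangarooAtlas.Mizutani

end
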